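import Summits.QuantumFields.BalabanUV.Beta.FP.NestedStepLawOneShot

/-!
# The slice exchange WITHOUT unimodularity: the Faddeev–Popov second variations displayed (road «FP», route T row (SX-STEP), fallback R-FP-52 (4))

Owner file of road «FP» (unit `b2b-balaban-beta-d1-p3`, gen 17).  `NestedSliceExchange.secondVar_kkt_slice_change_of_const` (p306639) exchanges two slices `P`, `τ`
of one sliced bordered family `kkt K [Q; ·]` at the level of second variations when BOTH Faddeev–Popov determinants `det(P·W)`, `det(τ·W)` have CONSTANT
modulus along the background curve ((UNI): comb ∕ tree slices, R-FP-52 (2)).  This file removes (UNI): for `C²` gauge generators `W` the two sliced systems'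
second variations differ by TWICE the difference of the second variations of `log|det|` of the two Faddeev–Popov curves — DISPLAYED as `secondVar` of the
2-jets of `u ↦ P(u)·W(u)` and `u ↦ τ(u)·W(u)`:
  `secondVar (P-sliced) = secondVar (τ-sliced) + 2·(secondVar (PW)₀ (PW)˙ (PW)¨ − secondVar (τW)₀ (τW)˙ (τW)¨)`.
This is the model theorem of R-FP-52's FALLBACK (4) (a chart whose slice is NOT unimodular — e.g. the `(0.4)`-symmetrised slice — pays an explicit, displayed
Faddeev–Popov second variation, an3's `K_step`), and it recovers p306639's statement when both FP moduli are constant (both displayed terms vanish).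
* §1 `secondVar_eq_add_of_logAbsDet_eq_add` — the `φ`-form of road BF-x's uniqueness lemma `LogDetSecondVariation.secondVar_eq_of_logAbsDet_eq`: two `C²` matrix
  curves with `log|det A| = log|det B| + φ` near `t`, `φ` twice differentiable at `t` ⇒ `secondVar A = secondVar B + φ''(t)`.
* §2 `hasDerivAt_logAbsDet_two_curves` plumbing and **`secondVar_kkt_slice_change`** (hypotheses: `C²` curves `K, Q, τ, P, W`; near `0` the relations `Q·W = 0`,
  `K·W = QᵀY`, `Kᵀ·W = QᵀY'` (gauge invariance on `ker Q`, an3 (F2)); AT `0` only: `det(τ₀W₀) ≠ 0`, `det(P₀W₀) ≠ 0`, `det kkt K₀ [Q₀;τ₀] ≠ 0`).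
* §3 **`secondVar_oneShot_nestedStepLaw_defect`** — the integration theorem `NestedStepLawOneShot.secondVar_oneShot_nestedStepLaw` (p307295) WITHOUT (UNI) and with an
  ABSTRACT `C²` generator curve `W` (hypotheses near `0`: `(Q₂Q₁)·W = 0`, `𝔎·W = (Q₂Q₁)ᵀY`, `𝔎ᵀ·W = (Q₂Q₁)ᵀY'`; at `0`: the two FP operators `P₀W₀`, `[τ₂Q₁₀;τ₁]W₀` non-degenerate):
  one-shot-sliced composite = fine one-step sliced + COARSE SLICED + `2·secondVar`(2-jet of `P·W`) − `2·secondVar`(2-jet of `[τ₂Q₁;τ₁]·W`), every jet displayed.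
HONEST: model-level calculus of `log|det|`; which slices the road uses and what their FP second variations are is NOT decided here; nothing here is the road's
(SDF), (D1), BetaPertH, a continuum statement or Clay.  HONEST DEPENDENCY: continuum YM on T⁴ ⇐ BetaPertH ∧ nine spine estimates (0/9 proved); BetaPertH ⇐ (D1) ∧
(D4) ∧ CAP+tail; G-an2-4 gates asym, D1 and NE2/3/4.
-/

noncomputable section

namespace Summit.QuantumFields.BalabanUV.Beta.FP.SliceExchangeDefect

open Matrix Filter Finset
open scoped Topology
open Literature.MathematicalPhysics.QuantumFieldTheory.Balaban1983to89.Beta.Composition (kkt)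
open Summit.QuantumFields.BalabanUV.Beta.D1BFx.LogDetSecondVariation (secondVar hasDerivAt_logAbsDet hasDerivAt_trace_inv_mul)
open Summit.QuantumFields.BalabanUV.Beta.D1BFx.SliceTransferModel (hasDerivAt_matMul hasDerivAt_kkt_fromRows)
open Summit.QuantumFields.BalabanUV.Beta.FP.NestedStepLawMovingBorder (hasDerivAt_mul_curves_jet)
open Summit.QuantumFields.BalabanUV.Beta.FP.NestedSliceExchange (det_kkt_fromRows_slice_change_of_range)
open Literature.MathematicalPhysics.QuantumFieldTheory.Balaban1983to89.Beta.CompositionSingular (effForm flucCov minOp minOpL)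
open Literature.MathematicalPhysics.QuantumFieldTheory.Balaban1983to89.Beta.SliceComposition (det_kkt_reindex fromRows_assoc)
open Summit.QuantumFields.BalabanUV.Beta.FP.NestedStepLawMovingBorder (hasDerivAt_compForm_curves_jet)
open Summit.QuantumFields.BalabanUV.Beta.FP.NestedStepLawSliced (hasDerivAt_fromRows_const)
open Summit.QuantumFields.BalabanUV.Beta.FP.NestedStepLawJets (hasDerivAt_const_mul hasDerivAt_compFormSliced)
open Summit.QuantumFields.BalabanUV.Beta.FP.NestedStepLawJetsCorner (secondVar_nestedStepLaw_corner)
open Summit.QuantumFields.BalabanUV.Beta.FP.NestedStepLawOneShot (secondVar_kkt_fromRows_assoc det_kkt_compSliced_ne_zero)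
open Literature.Analysis.Calculus (eventually_det_ne_zero)

/-! ## §1 Uniqueness of the second variation up to a displayed scalar -/

section Phi

variable {ι : Type*} [Fintype ι] [DecidableEq ι]

/-- [folklore] **UNIQUENESS OF THE SECOND VARIATION, `φ`-FORM**: two matrix curves `A`, `B`, each with first derivatives near `t`, a second derivative at `t` and
`det ≠ 0` at `t`, and a scalar function `φ` with first derivatives near `t` and a second derivative `φ₂` at `t`; if `log|det A| = log|det B| + φ` near `t` then
`secondVar (A t) (A₁ t) A₂ = secondVar (B t) (B₁ t) B₂ + φ₂`.  (`φ` constant: `LogDetSecondVariation.secondVar_eq_of_logAbsDet_eq`.) -/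
theorem secondVar_eq_add_of_logAbsDet_eq_add {A A₁ B B₁ : ℝ → ι → ι → ℝ} {A₂ B₂ : Matrix ι ι ℝ} {φ φ₁ : ℝ → ℝ} {φ₂ t : ℝ}
    (hA : ∀ᶠ u in 𝓝 t, HasDerivAt A (A₁ u) u) (hA₁ : HasDerivAt A₁ (A₂ : ι → ι → ℝ) t) (hdA : (Matrix.of (A t)).det ≠ 0)
    (hB : ∀ᶠ u in 𝓝 t, HasDerivAt B (B₁ u) u) (hB₁ : HasDerivAt B₁ (B₂ : ι → ι → ℝ) t) (hdB : (Matrix.of (B t)).det ≠ 0)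
    (hφ : ∀ᶠ u in 𝓝 t, HasDerivAt φ (φ₁ u) u) (hφ₁ : HasDerivAt φ₁ φ₂ t)
    (heq : ∀ᶠ u in 𝓝 t, Real.log |(Matrix.of (A u)).det| = Real.log |(Matrix.of (B u)).det| + φ u) :
    secondVar (Matrix.of (A t)) (Matrix.of (A₁ t)) A₂ = secondVar (Matrix.of (B t)) (Matrix.of (B₁ t)) B₂ + φ₂ := by
  have hAt : HasDerivAt A (A₁ t) t := hA.self_of_nhds
  have hBt : HasDerivAt B (B₁ t) t := hB.self_of_nhds
  have hdA' : ∀ᶠ u in 𝓝 t, (Matrix.of (A u)).det ≠ 0 := eventually_det_ne_zero hAt.hasFDerivAt hdA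
  have hdB' : ∀ᶠ u in 𝓝 t, (Matrix.of (B u)).det ≠ 0 := eventually_det_ne_zero hBt.hasFDerivAt hdB
  -- first derivatives near `t`
  have hfirst : ∀ᶠ u in 𝓝 t, ((Matrix.of (A u))⁻¹ * Matrix.of (A₁ u)).trace = ((Matrix.of (B u))⁻¹ * Matrix.of (B₁ u)).trace + φ₁ u := by
    have hev : ∀ᶠ u in 𝓝 t, ∀ᶠ v in 𝓝 u, Real.log |(Matrix.of (A v)).det| = Real.log |(Matrix.of (B v)).det| + φ v := heq.eventually_nhds
    filter_upwards [hA, hB, hdA', hdB', hφ, hev] with u huA huB hduA hduB huφ hequ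
    have h1 : HasDerivAt (fun v => Real.log |(Matrix.of (A v)).det|) (((Matrix.of (A u))⁻¹ * Matrix.of (A₁ u)).trace) u :=
      hasDerivAt_logAbsDet (A₁ := Matrix.of (A₁ u)) huA hduA
    have h2 : HasDerivAt (fun v => Real.log |(Matrix.of (B v)).det| + φ v) (((Matrix.of (B u))⁻¹ * Matrix.of (B₁ u)).trace + φ₁ u) u :=
      (hasDerivAt_logAbsDet (A₁ := Matrix.of (B₁ u)) huB hduB).add huφ
    exact h1.unique (h2.congr_of_eventuallyEq hequ)
  -- differentiate once more at `t`
  have h2A := hasDerivAt_trace_inv_mul hAt hA₁ hdA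
  have h2B := (hasDerivAt_trace_inv_mul hBt hB₁ hdB).add hφ₁
  exact h2A.unique (h2B.congr_of_eventuallyEq hfirst)

end Phi

/-! ## §2 The slice exchange with the Faddeev–Popov second variations displayed -/

section SliceChange

variable {ν μ ρ : Type*} [Fintype ν] [Fintype μ] [Fintype ρ] [DecidableEq ν] [DecidableEq μ] [DecidableEq ρ]

/-- [folklore] **THE SLICE EXCHANGE WITHOUT UNIMODULARITY.**  Along `C²` background curves of the form `K`, the averaging `Q`, TWO slices `τ`, `P` and the gauge
generators `W` (all moving, first-jet curves near `0`, second jets at `0`), with near `0`: `Q·W = 0`, `K·W = QᵀY`, `Kᵀ·W = QᵀY'` (gauge invariance on `ker Q`), and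
AT `0`: both Faddeev–Popov operators `τ₀W₀`, `P₀W₀` and the `τ`-sliced system `kkt K₀ [Q₀;τ₀]` non-degenerate.  CONCLUSION: the `P`-sliced and the `τ`-sliced bordered
systems' second variations of `log|det|` at `0` differ by twice the difference of the second variations of `log|det(P·W)|` and `log|det(τ·W)|`, displayed as
`secondVar` of the product 2-jets `((PW)₀, ṖW + PẆ, P̈W + 2ṖẆ + PẄ)` (resp. `τ`).  PROOF: §1 of p306639 pointwise gives `log|det A| + 2log|det τW| = log|det B| + 2log|det PW|`
near `0`; §1 above with `φ = 2log|det PW| − 2log|det τW|`. -/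
theorem secondVar_kkt_slice_change
    {K K₁ : ℝ → ν → ν → ℝ} {K₂ : Matrix ν ν ℝ} {Q Q₁ : ℝ → μ → ν → ℝ} {Q₂ : Matrix μ ν ℝ}
    {τ τ₁ : ℝ → ρ → ν → ℝ} {τ₂ : Matrix ρ ν ℝ} {P P₁ : ℝ → ρ → ν → ℝ} {P₂ : Matrix ρ ν ℝ}
    {W W₁ : ℝ → ν → ρ → ℝ} {W₂ : Matrix ν ρ ℝ} {Y Y' : ℝ → μ → ρ → ℝ}
    (hK : ∀ᶠ u in 𝓝 (0 : ℝ), HasDerivAt K (K₁ u) u) (hK₁ : HasDerivAt K₁ (Matrix.of.symm K₂) 0)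
    (hQ : ∀ᶠ u in 𝓝 (0 : ℝ), HasDerivAt Q (Q₁ u) u) (hQ₁ : HasDerivAt Q₁ (Matrix.of.symm Q₂) 0)
    (hτ : ∀ᶠ u in 𝓝 (0 : ℝ), HasDerivAt τ (τ₁ u) u) (hτ₁ : HasDerivAt τ₁ (Matrix.of.symm τ₂) 0)
    (hP : ∀ᶠ u in 𝓝 (0 : ℝ), HasDerivAt P (P₁ u) u) (hP₁ : HasDerivAt P₁ (Matrix.of.symm P₂) 0)
    (hW : ∀ᶠ u in 𝓝 (0 : ℝ), HasDerivAt W (W₁ u) u) (hW₁ : HasDerivAt W₁ (Matrix.of.symm W₂) 0)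
    (hKW : ∀ᶠ u in 𝓝 (0 : ℝ), Matrix.of (K u) * Matrix.of (W u) = (Matrix.of (Q u))ᵀ * Matrix.of (Y u))
    (hKtW : ∀ᶠ u in 𝓝 (0 : ℝ), (Matrix.of (K u))ᵀ * Matrix.of (W u) = (Matrix.of (Q u))ᵀ * Matrix.of (Y' u))
    (hQW : ∀ᶠ u in 𝓝 (0 : ℝ), Matrix.of (Q u) * Matrix.of (W u) = 0)
    (hτW0 : (Matrix.of (τ 0) * Matrix.of (W 0)).det ≠ 0) (hPW0 : (Matrix.of (P 0) * Matrix.of (W 0)).det ≠ 0)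
    (h0 : (kkt (Matrix.of (K 0)) (fromRows (Matrix.of (Q 0)) (Matrix.of (τ 0)))).det ≠ 0) :
    secondVar (kkt (Matrix.of (K 0)) (fromRows (Matrix.of (Q 0)) (Matrix.of (P 0))))
        (kkt (Matrix.of (K₁ 0)) (fromRows (Matrix.of (Q₁ 0)) (Matrix.of (P₁ 0)))) (kkt K₂ (fromRows Q₂ P₂))
      = secondVar (kkt (Matrix.of (K 0)) (fromRows (Matrix.of (Q 0)) (Matrix.of (τ 0))))
          (kkt (Matrix.of (K₁ 0)) (fromRows (Matrix.of (Q₁ 0)) (Matrix.of (τ₁ 0)))) (kkt K₂ (fromRows Q₂ τ₂))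
        + (2 * secondVar (Matrix.of (P 0) * Matrix.of (W 0)) (Matrix.of (P₁ 0) * Matrix.of (W 0) + Matrix.of (P 0) * Matrix.of (W₁ 0))
              (P₂ * Matrix.of (W 0) + Matrix.of (P₁ 0) * Matrix.of (W₁ 0) + (Matrix.of (P₁ 0) * Matrix.of (W₁ 0) + Matrix.of (P 0) * W₂))
          - 2 * secondVar (Matrix.of (τ 0) * Matrix.of (W 0)) (Matrix.of (τ₁ 0) * Matrix.of (W 0) + Matrix.of (τ 0) * Matrix.of (W₁ 0))
              (τ₂ * Matrix.of (W 0) + Matrix.of (τ₁ 0) * Matrix.of (W₁ 0) + (Matrix.of (τ₁ 0) * Matrix.of (W₁ 0) + Matrix.of (τ 0) * W₂))) := by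
  have hK' : ∀ᶠ u in 𝓝 (0 : ℝ), HasDerivAt K (Matrix.of.symm (Matrix.of (K₁ u))) u := hK
  have hQ' : ∀ᶠ u in 𝓝 (0 : ℝ), HasDerivAt Q (Matrix.of.symm (Matrix.of (Q₁ u))) u := hQ
  have hτ' : ∀ᶠ u in 𝓝 (0 : ℝ), HasDerivAt τ (Matrix.of.symm (Matrix.of (τ₁ u))) u := hτ
  have hP' : ∀ᶠ u in 𝓝 (0 : ℝ), HasDerivAt P (Matrix.of.symm (Matrix.of (P₁ u))) u := hP
  have hW' : ∀ᶠ u in 𝓝 (0 : ℝ), HasDerivAt W (Matrix.of.symm (Matrix.of (W₁ u))) u := hW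
  have hτ0 : HasDerivAt τ (τ₁ 0) 0 := hτ.self_of_nhds
  have hP0 : HasDerivAt P (P₁ 0) 0 := hP.self_of_nhds
  have hW0 : HasDerivAt W (W₁ 0) 0 := hW.self_of_nhds
  -- the two sliced bordered curves and their jets
  have hAd : ∀ᶠ u in 𝓝 (0 : ℝ), HasDerivAt (fun u => Matrix.of.symm (kkt (Matrix.of (K u)) (fromRows (Matrix.of (Q u)) (Matrix.of (P u)))))
      ((fun u => Matrix.of.symm (kkt (Matrix.of (K₁ u)) (fromRows (Matrix.of (Q₁ u)) (Matrix.of (P₁ u))))) u) u := by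
    filter_upwards [hK', hQ', hP'] with u huK huQ huP
    exact hasDerivAt_kkt_fromRows huK huQ huP
  have hA₁d : HasDerivAt (fun u => Matrix.of.symm (kkt (Matrix.of (K₁ u)) (fromRows (Matrix.of (Q₁ u)) (Matrix.of (P₁ u)))))
      (Matrix.of.symm (kkt K₂ (fromRows Q₂ P₂))) 0 := hasDerivAt_kkt_fromRows hK₁ hQ₁ hP₁
  have hBd : ∀ᶠ u in 𝓝 (0 : ℝ), HasDerivAt (fun u => Matrix.of.symm (kkt (Matrix.of (K u)) (fromRows (Matrix.of (Q u)) (Matrix.of (τ u)))))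
      ((fun u => Matrix.of.symm (kkt (Matrix.of (K₁ u)) (fromRows (Matrix.of (Q₁ u)) (Matrix.of (τ₁ u))))) u) u := by
    filter_upwards [hK', hQ', hτ'] with u huK huQ huτ
    exact hasDerivAt_kkt_fromRows huK huQ huτ
  have hB₁d : HasDerivAt (fun u => Matrix.of.symm (kkt (Matrix.of (K₁ u)) (fromRows (Matrix.of (Q₁ u)) (Matrix.of (τ₁ u)))))
      (Matrix.of.symm (kkt K₂ (fromRows Q₂ τ₂))) 0 := hasDerivAt_kkt_fromRows hK₁ hQ₁ hτ₁
  -- the two Faddeev–Popov curves `C = P·W`, `D = τ·W` and their jets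
  have hCd : ∀ᶠ u in 𝓝 (0 : ℝ), HasDerivAt (fun u => Matrix.of.symm (Matrix.of (P u) * Matrix.of (W u)))
      ((fun u => Matrix.of.symm (Matrix.of (P₁ u) * Matrix.of (W u) + Matrix.of (P u) * Matrix.of (W₁ u))) u) u := by
    filter_upwards [hP', hW'] with u huP huW
    exact hasDerivAt_matMul huP huW
  have hC₁d := hasDerivAt_mul_curves_jet hP0 hP₁ hW0 hW₁
  have hDd : ∀ᶠ u in 𝓝 (0 : ℝ), HasDerivAt (fun u => Matrix.of.symm (Matrix.of (τ u) * Matrix.of (W u)))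
      ((fun u => Matrix.of.symm (Matrix.of (τ₁ u) * Matrix.of (W u) + Matrix.of (τ u) * Matrix.of (W₁ u))) u) u := by
    filter_upwards [hτ', hW'] with u huτ huW
    exact hasDerivAt_matMul huτ huW
  have hD₁d := hasDerivAt_mul_curves_jet hτ0 hτ₁ hW0 hW₁
  -- non-degeneracy near `0` of the `τ`-sliced system and of the two FP operators
  have hB0 : (Matrix.of ((fun u => Matrix.of.symm (kkt (Matrix.of (K u)) (fromRows (Matrix.of (Q u)) (Matrix.of (τ u))))) 0)).det ≠ 0 := by
    simpa only [Equiv.apply_symm_apply] using h0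
  have hC0 : (Matrix.of ((fun u => Matrix.of.symm (Matrix.of (P u) * Matrix.of (W u))) 0)).det ≠ 0 := by
    simpa only [Equiv.apply_symm_apply] using hPW0
  have hD0 : (Matrix.of ((fun u => Matrix.of.symm (Matrix.of (τ u) * Matrix.of (W u))) 0)).det ≠ 0 := by
    simpa only [Equiv.apply_symm_apply] using hτW0
  have hBne := eventually_det_ne_zero hBd.self_of_nhds.hasFDerivAt hB0
  have hCne := eventually_det_ne_zero hCd.self_of_nhds.hasFDerivAt hC0
  have hDne := eventually_det_ne_zero hDd.self_of_nhds.hasFDerivAt hD0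
  -- p306639 §1 pointwise: the `P`-sliced system is non-degenerate and `log|det A| = log|det B| + (2log|det PW| − 2log|det τW|)` near `0`
  have hpt : ∀ᶠ u in 𝓝 (0 : ℝ),
      (Matrix.of ((fun u => Matrix.of.symm (kkt (Matrix.of (K u)) (fromRows (Matrix.of (Q u)) (Matrix.of (P u))))) u)).det ≠ 0 ∧
      Real.log |(Matrix.of ((fun u => Matrix.of.symm (kkt (Matrix.of (K u)) (fromRows (Matrix.of (Q u)) (Matrix.of (P u))))) u)).det|
        = Real.log |(Matrix.of ((fun u => Matrix.of.symm (kkt (Matrix.of (K u)) (fromRows (Matrix.of (Q u)) (Matrix.of (τ u))))) u)).det|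
          + (fun u => 2 * Real.log |(Matrix.of ((fun u => Matrix.of.symm (Matrix.of (P u) * Matrix.of (W u))) u)).det|
              - 2 * Real.log |(Matrix.of ((fun u => Matrix.of.symm (Matrix.of (τ u) * Matrix.of (W u))) u)).det|) u := by
    filter_upwards [hKW, hKtW, hQW, hBne, hCne, hDne] with u huK huKt huQ huB huC huD
    simp only [Equiv.apply_symm_apply] at huB huC huD ⊢
    have hid := det_kkt_fromRows_slice_change_of_range (Matrix.of (K u)) (Matrix.of (Q u)) (Matrix.of (τ u)) (Matrix.of (P u)) (Matrix.of (W u))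
      (Matrix.of (Y u)) (Matrix.of (Y' u)) huK huKt huQ (isUnit_iff_ne_zero.2 huD) (isUnit_iff_ne_zero.2 huC)
    have habs := congrArg (fun x : ℝ => |x|) hid
    simp only [abs_mul, abs_pow] at habs
    have hBpos : 0 < |(kkt (Matrix.of (K u)) (fromRows (Matrix.of (Q u)) (Matrix.of (τ u)))).det| := abs_pos.2 huB
    have hCpos : 0 < |(Matrix.of (P u) * Matrix.of (W u)).det| := abs_pos.2 huC
    have hDpos : 0 < |(Matrix.of (τ u) * Matrix.of (W u)).det| := abs_pos.2 huD
    have hAne : (kkt (Matrix.of (K u)) (fromRows (Matrix.of (Q u)) (Matrix.of (P u)))).det ≠ 0 := by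
      intro hz
      rw [hz, abs_zero, zero_mul] at habs
      exact (mul_pos hBpos (pow_pos hCpos 2)).ne habs
    have hApos : 0 < |(kkt (Matrix.of (K u)) (fromRows (Matrix.of (Q u)) (Matrix.of (P u)))).det| := abs_pos.2 hAne
    refine ⟨hAne, ?_⟩
    have hlog' := congrArg Real.log habs
    rw [Real.log_mul hApos.ne' (pow_pos hDpos 2).ne', Real.log_mul hBpos.ne' (pow_pos hCpos 2).ne', Real.log_pow, Real.log_pow] at hlog'
    push_cast at hlog'
    linarith
  have hA0 := (hpt.self_of_nhds).1
  have hlog := hpt.mono fun u hu => hu.2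
  -- `φ = 2log|det PW| − 2log|det τW|` is twice differentiable, `φ'' (0) = 2·secondVar (PW) − 2·secondVar (τW)`
  have hφ : ∀ᶠ u in 𝓝 (0 : ℝ), HasDerivAt
      (fun u => 2 * Real.log |(Matrix.of ((fun u => Matrix.of.symm (Matrix.of (P u) * Matrix.of (W u))) u)).det|
        - 2 * Real.log |(Matrix.of ((fun u => Matrix.of.symm (Matrix.of (τ u) * Matrix.of (W u))) u)).det|)
      ((fun u => 2 * ((Matrix.of ((fun u => Matrix.of.symm (Matrix.of (P u) * Matrix.of (W u))) u))⁻¹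
            * Matrix.of ((fun u => Matrix.of.symm (Matrix.of (P₁ u) * Matrix.of (W u) + Matrix.of (P u) * Matrix.of (W₁ u))) u)).trace
        - 2 * ((Matrix.of ((fun u => Matrix.of.symm (Matrix.of (τ u) * Matrix.of (W u))) u))⁻¹
            * Matrix.of ((fun u => Matrix.of.symm (Matrix.of (τ₁ u) * Matrix.of (W u) + Matrix.of (τ u) * Matrix.of (W₁ u))) u)).trace) u) u := by
    filter_upwards [hCd, hDd, hCne, hDne] with u huC huD huCne huDne
    have h1 := hasDerivAt_logAbsDet
      (A₁ := Matrix.of ((fun u => Matrix.of.symm (Matrix.of (P₁ u) * Matrix.of (W u) + Matrix.of (P u) * Matrix.of (W₁ u))) u)) huC huCne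
    have h2 := hasDerivAt_logAbsDet
      (A₁ := Matrix.of ((fun u => Matrix.of.symm (Matrix.of (τ₁ u) * Matrix.of (W u) + Matrix.of (τ u) * Matrix.of (W₁ u))) u)) huD huDne
    exact (h1.const_mul 2).sub (h2.const_mul 2)
  have hφ₁ := ((hasDerivAt_trace_inv_mul hCd.self_of_nhds hC₁d hC0).const_mul 2).sub
    ((hasDerivAt_trace_inv_mul hDd.self_of_nhds hD₁d hD0).const_mul 2)
  have h := secondVar_eq_add_of_logAbsDet_eq_add hAd hA₁d hA0 hBd hB₁d hB0 hφ hφ₁ hlog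
  simp only [Equiv.apply_symm_apply] at h
  exact h

end SliceChange

/-! ## §3 The one-shot-sliced composite step law WITHOUT unimodularity: the Faddeev–Popov defect displayed -/

section LawDefect

variable {ν μ κ ρ₁ ρ₂ : Type*} [Fintype ν] [Fintype μ] [Fintype κ] [Fintype ρ₁] [Fintype ρ₂]
  [DecidableEq ν] [DecidableEq μ] [DecidableEq κ] [DecidableEq ρ₁] [DecidableEq ρ₂]

/-- [folklore] **THE ONE-SHOT-SLICED COMPOSITE STEP LAW WITH THE FADDEEV–POPOV DEFECT DISPLAYED** (R-FP-52 (4) fallback at integration level).  DATA as in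
`NestedStepLawOneShot.secondVar_oneShot_nestedStepLaw` (`C²` curves `H, Q₁, Q₂, G, P`, static slices `τ₁, τ₂`, named values ∕ first jets, named blocks, (INV)), but with an
ABSTRACT `C²` generator curve `W` (first-jet curve `W₁`, second jet `W₂`, values `W₀, W₁₀` named) in place of `[D₂|D₁]` and NO unimodularity: near `0`, `(Q₂Q₁)·W = 0`,
`𝔎·W = (Q₂Q₁)ᵀY`, `𝔎ᵀ·W = (Q₂Q₁)ᵀY'` (`𝔎 = H + Q₁ᵀGQ₁`); at `0`, `det(P₀W₀) ≠ 0` and `det([τ₂Q₁₀;τ₁]W₀) ≠ 0`.  CONCLUSION: `secondVar` (one-shot-sliced composite 2-jet)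
`=` `secondVar` (fine one-step sliced) `+` `secondVar` (COARSE SLICED, transported jets) `+ 2·secondVar ((P·W) 2-jet) − 2·secondVar (([τ₂Q₁;τ₁]·W) 2-jet)` — the last two terms
are the second variations of `log|det|` of the one-shot and of the nested Faddeev–Popov operators; under (UNI) both vanish. -/
theorem secondVar_oneShot_nestedStepLaw_defect
    {H H₁ : ℝ → ν → ν → ℝ} {H₂ : Matrix ν ν ℝ} {Q₁ Q₁d : ℝ → μ → ν → ℝ} {Q₁dd : Matrix μ ν ℝ} {Q₂ Q₂d : ℝ → κ → μ → ℝ} {Q₂dd : Matrix κ μ ℝ}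
    {G Gd : ℝ → μ → μ → ℝ} {Gdd : Matrix μ μ ℝ} {P Pd : ℝ → (ρ₂ ⊕ ρ₁) → ν → ℝ} {Pdd : Matrix (ρ₂ ⊕ ρ₁) ν ℝ}
    {W Wd : ℝ → ν → (ρ₂ ⊕ ρ₁) → ℝ} {Wdd : Matrix ν (ρ₂ ⊕ ρ₁) ℝ}
    (hH : ∀ᶠ u in 𝓝 (0 : ℝ), HasDerivAt H (H₁ u) u) (hH₁ : HasDerivAt H₁ (Matrix.of.symm H₂) 0)
    (hQ₁ : ∀ᶠ u in 𝓝 (0 : ℝ), HasDerivAt Q₁ (Q₁d u) u) (hQ₁d : HasDerivAt Q₁d (Matrix.of.symm Q₁dd) 0)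
    (hQ₂ : ∀ᶠ u in 𝓝 (0 : ℝ), HasDerivAt Q₂ (Q₂d u) u) (hQ₂d : HasDerivAt Q₂d (Matrix.of.symm Q₂dd) 0)
    (hG : ∀ᶠ u in 𝓝 (0 : ℝ), HasDerivAt G (Gd u) u) (hGd : HasDerivAt Gd (Matrix.of.symm Gdd) 0)
    (hP : ∀ᶠ u in 𝓝 (0 : ℝ), HasDerivAt P (Pd u) u) (hPd : HasDerivAt Pd (Matrix.of.symm Pdd) 0)
    (hW : ∀ᶠ u in 𝓝 (0 : ℝ), HasDerivAt W (Wd u) u) (hWd : HasDerivAt Wd (Matrix.of.symm Wdd) 0)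
    (τ₁ : Matrix ρ₁ ν ℝ) (τ₂ : Matrix ρ₂ μ ℝ)
    -- the composite averaging kills the generators; gauge invariance of the composite form on `ker Q₂Q₁`
    {Y Y' : ℝ → κ → (ρ₂ ⊕ ρ₁) → ℝ}
    (hQW : ∀ᶠ u in 𝓝 (0 : ℝ), Matrix.of (Q₂ u) * Matrix.of (Q₁ u) * Matrix.of (W u) = 0)
    (hKW : ∀ᶠ u in 𝓝 (0 : ℝ), (Matrix.of (H u) + (Matrix.of (Q₁ u))ᵀ * Matrix.of (G u) * Matrix.of (Q₁ u)) * Matrix.of (W u)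
      = (Matrix.of (Q₂ u) * Matrix.of (Q₁ u))ᵀ * Matrix.of (Y u))
    (hKtW : ∀ᶠ u in 𝓝 (0 : ℝ), (Matrix.of (H u) + (Matrix.of (Q₁ u))ᵀ * Matrix.of (G u) * Matrix.of (Q₁ u))ᵀ * Matrix.of (W u)
      = (Matrix.of (Q₂ u) * Matrix.of (Q₁ u))ᵀ * Matrix.of (Y' u))
    -- values and first jets at `0`, NAMED
    {H₀ H₁₀ : Matrix ν ν ℝ} {Q₁₀ Q₁₁ : Matrix μ ν ℝ} {Q₂₀ Q₂₁ : Matrix κ μ ℝ} {G₀ G₁ : Matrix μ μ ℝ} {P₀ P₁ : Matrix (ρ₂ ⊕ ρ₁) ν ℝ}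
    {W₀ W₁₀ : Matrix ν (ρ₂ ⊕ ρ₁) ℝ}
    (hH₀ : Matrix.of (H 0) = H₀) (hH₁₀ : Matrix.of (H₁ 0) = H₁₀) (hQ₁₀ : Matrix.of (Q₁ 0) = Q₁₀) (hQ₁₁ : Matrix.of (Q₁d 0) = Q₁₁)
    (hQ₂₀ : Matrix.of (Q₂ 0) = Q₂₀) (hQ₂₁ : Matrix.of (Q₂d 0) = Q₂₁) (hG₀ : Matrix.of (G 0) = G₀) (hG₁ : Matrix.of (Gd 0) = G₁)
    (hP₀ : Matrix.of (P 0) = P₀) (hP₁ : Matrix.of (Pd 0) = P₁) (hW₀ : Matrix.of (W 0) = W₀) (hW₁₀ : Matrix.of (Wd 0) = W₁₀)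
    -- the two Faddeev–Popov operators are non-degenerate AT `0`
    (hPW0 : (P₀ * W₀).det ≠ 0) (hTW0 : (fromRows (τ₂ * Q₁₀) τ₁ * W₀).det ≠ 0)
    -- blocks of the inverse of the fine sliced system at `0` and the sliced border jet, NAMED
    {Γ : Matrix ν ν ℝ} {I : Matrix ν (μ ⊕ ρ₁) ℝ} {L : Matrix (μ ⊕ ρ₁) ν ℝ} {S : Matrix (μ ⊕ ρ₁) (μ ⊕ ρ₁) ℝ} {B : Matrix (μ ⊕ ρ₁) ν ℝ}
    (hΓ : flucCov H₀ (fromRows Q₁₀ τ₁) = Γ) (hI : minOp H₀ (fromRows Q₁₀ τ₁) = I) (hL : minOpL H₀ (fromRows Q₁₀ τ₁) = L) (hS : effForm H₀ (fromRows Q₁₀ τ₁) = S)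
    (hB : fromRows Q₁₁ (0 : Matrix ρ₁ ν ℝ) = B)
    -- (INV)
    (h1 : (kkt H₀ (fromRows Q₁₀ τ₁)).det ≠ 0)
    (h2 : (kkt (S.toBlocks₁₁ + G₀) (fromRows Q₂₀ τ₂)).det ≠ 0) :
    secondVar
        (kkt (H₀ + Q₁₀ᵀ * G₀ * Q₁₀) (fromRows (Q₂₀ * Q₁₀) P₀))
        (kkt (H₁₀ + (Q₁₁ᵀ * G₀ * Q₁₀ + Q₁₀ᵀ * G₁ * Q₁₀ + Q₁₀ᵀ * G₀ * Q₁₁)) (fromRows (Q₂₁ * Q₁₀ + Q₂₀ * Q₁₁) P₁))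
        (kkt (H₂ + ((Q₁ddᵀ * G₀ * Q₁₀ + Q₁₁ᵀ * G₁ * Q₁₀ + Q₁₁ᵀ * G₀ * Q₁₁) + (Q₁₁ᵀ * G₁ * Q₁₀ + Q₁₀ᵀ * Gdd * Q₁₀ + Q₁₀ᵀ * G₁ * Q₁₁)
            + (Q₁₁ᵀ * G₀ * Q₁₁ + Q₁₀ᵀ * G₁ * Q₁₁ + Q₁₀ᵀ * G₀ * Q₁dd)))
          (fromRows (Q₂dd * Q₁₀ + Q₂₁ * Q₁₁ + (Q₂₁ * Q₁₁ + Q₂₀ * Q₁dd)) Pdd))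
      = secondVar (kkt H₀ (fromRows Q₁₀ τ₁)) (kkt H₁₀ B) (kkt H₂ (fromRows Q₁dd (0 : Matrix ρ₁ ν ℝ)))
        + secondVar
            (kkt (S.toBlocks₁₁ + G₀) (fromRows Q₂₀ τ₂))
            (kkt (((L * H₁₀ - S * B) * I - L * Bᵀ * S).toBlocks₁₁ + G₁) (fromRows Q₂₁ (0 : Matrix ρ₂ μ ℝ)))
            (kkt ((((-((L * H₁₀ - S * B) * Γ + L * Bᵀ * L) * H₁₀ + L * H₂
                      - (((L * H₁₀ - S * B) * I - L * Bᵀ * S) * B + S * fromRows Q₁dd (0 : Matrix ρ₁ ν ℝ))) * I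
                    + (L * H₁₀ - S * B) * (-((Γ * H₁₀ + I * B) * I - Γ * Bᵀ * S)))
                  - ((-((L * H₁₀ - S * B) * Γ + L * Bᵀ * L) * Bᵀ + L * (fromRows Q₁dd (0 : Matrix ρ₁ ν ℝ))ᵀ) * S
                      + L * Bᵀ * ((L * H₁₀ - S * B) * I - L * Bᵀ * S))).toBlocks₁₁ + Gdd)
              (fromRows Q₂dd (0 : Matrix ρ₂ μ ℝ)))
        + (2 * secondVar (P₀ * W₀) (P₁ * W₀ + P₀ * W₁₀) (Pdd * W₀ + P₁ * W₁₀ + (P₁ * W₁₀ + P₀ * Wdd))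
          - 2 * secondVar (fromRows (τ₂ * Q₁₀) τ₁ * W₀) (fromRows (τ₂ * Q₁₁) (0 : Matrix ρ₁ ν ℝ) * W₀ + fromRows (τ₂ * Q₁₀) τ₁ * W₁₀)
              (fromRows (τ₂ * Q₁dd) (0 : Matrix ρ₁ ν ℝ) * W₀ + fromRows (τ₂ * Q₁₁) (0 : Matrix ρ₁ ν ℝ) * W₁₀
                + (fromRows (τ₂ * Q₁₁) (0 : Matrix ρ₁ ν ℝ) * W₁₀ + fromRows (τ₂ * Q₁₀) τ₁ * Wdd))) := by
  -- jets at `0` in curve form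
  have hQ₁0 : HasDerivAt Q₁ (Q₁d 0) 0 := hQ₁.self_of_nhds
  have hQ₂0 : HasDerivAt Q₂ (Q₂d 0) 0 := hQ₂.self_of_nhds
  have hG0 : HasDerivAt G (Gd 0) 0 := hG.self_of_nhds
  -- the composite form, the composite averaging and the nested comb slice as curves with their jets
  have h𝔎 : ∀ᶠ u in 𝓝 (0 : ℝ), HasDerivAt (fun v => Matrix.of.symm (Matrix.of (H v) + (Matrix.of (Q₁ v))ᵀ * Matrix.of (G v) * Matrix.of (Q₁ v)))
      ((fun u => Matrix.of.symm (Matrix.of (H₁ u) + ((Matrix.of (Q₁d u))ᵀ * Matrix.of (G u) * Matrix.of (Q₁ u)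
        + (Matrix.of (Q₁ u))ᵀ * Matrix.of (Gd u) * Matrix.of (Q₁ u) + (Matrix.of (Q₁ u))ᵀ * Matrix.of (G u) * Matrix.of (Q₁d u)))) u) u := by
    filter_upwards [hH, hQ₁, hG] with u huH huQ huG
    have huH' : HasDerivAt H (Matrix.of.symm (Matrix.of (H₁ u))) u := huH
    have huQ' : HasDerivAt Q₁ (Matrix.of.symm (Matrix.of (Q₁d u))) u := huQ
    have huG' : HasDerivAt G (Matrix.of.symm (Matrix.of (Gd u))) u := huG
    exact hasDerivAt_compFormSliced huH' huQ' huG'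
  have h𝔎₁ := hasDerivAt_compForm_curves_jet hH₁ hQ₁0 hQ₁d hG0 hGd
  have h𝔔 : ∀ᶠ u in 𝓝 (0 : ℝ), HasDerivAt (fun v => Matrix.of.symm (Matrix.of (Q₂ v) * Matrix.of (Q₁ v)))
      ((fun u => Matrix.of.symm (Matrix.of (Q₂d u) * Matrix.of (Q₁ u) + Matrix.of (Q₂ u) * Matrix.of (Q₁d u))) u) u := by
    filter_upwards [hQ₁, hQ₂] with u huQ₁ huQ₂
    have huQ₁' : HasDerivAt Q₁ (Matrix.of.symm (Matrix.of (Q₁d u))) u := huQ₁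
    have huQ₂' : HasDerivAt Q₂ (Matrix.of.symm (Matrix.of (Q₂d u))) u := huQ₂
    exact hasDerivAt_matMul huQ₂' huQ₁'
  have h𝔔₁ := hasDerivAt_mul_curves_jet hQ₂0 hQ₂d hQ₁0 hQ₁d
  have h𝔗 : ∀ᶠ u in 𝓝 (0 : ℝ), HasDerivAt (fun v => Matrix.of.symm (fromRows (τ₂ * Matrix.of (Q₁ v)) τ₁))
      ((fun u => Matrix.of.symm (fromRows (τ₂ * Matrix.of (Q₁d u)) (0 : Matrix ρ₁ ν ℝ))) u) u := by
    filter_upwards [hQ₁] with u huQ₁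
    have huQ₁' : HasDerivAt Q₁ (Matrix.of.symm (Matrix.of (Q₁d u))) u := huQ₁
    have h := hasDerivAt_fromRows_const τ₁ (hasDerivAt_const_mul τ₂ huQ₁')
    simp only [Equiv.apply_symm_apply] at h
    exact h
  have h𝔗₁ : HasDerivAt (fun u => Matrix.of.symm (fromRows (τ₂ * Matrix.of (Q₁d u)) (0 : Matrix ρ₁ ν ℝ)))
      (Matrix.of.symm (fromRows (τ₂ * Q₁dd) (0 : Matrix ρ₁ ν ℝ))) 0 := by
    have h := hasDerivAt_fromRows_const (0 : Matrix ρ₁ ν ℝ) (hasDerivAt_const_mul τ₂ hQ₁d)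
    simp only [Equiv.apply_symm_apply] at h
    exact h
  -- the relations in the composite curves' shapes
  have hQW' : ∀ᶠ u in 𝓝 (0 : ℝ), Matrix.of ((fun v => Matrix.of.symm (Matrix.of (Q₂ v) * Matrix.of (Q₁ v))) u) * Matrix.of (W u) = 0 := by
    filter_upwards [hQW] with u hu
    simpa only [Equiv.apply_symm_apply] using hu
  have hKW' : ∀ᶠ u in 𝓝 (0 : ℝ), Matrix.of ((fun v => Matrix.of.symm (Matrix.of (H v) + (Matrix.of (Q₁ v))ᵀ * Matrix.of (G v) * Matrix.of (Q₁ v))) u)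
      * Matrix.of (W u) = (Matrix.of ((fun v => Matrix.of.symm (Matrix.of (Q₂ v) * Matrix.of (Q₁ v))) u))ᵀ * Matrix.of (Y u) := by
    filter_upwards [hKW] with u hu
    simpa only [Equiv.apply_symm_apply] using hu
  have hKtW' : ∀ᶠ u in 𝓝 (0 : ℝ), (Matrix.of ((fun v => Matrix.of.symm (Matrix.of (H v) + (Matrix.of (Q₁ v))ᵀ * Matrix.of (G v) * Matrix.of (Q₁ v))) u))ᵀ
      * Matrix.of (W u) = (Matrix.of ((fun v => Matrix.of.symm (Matrix.of (Q₂ v) * Matrix.of (Q₁ v))) u))ᵀ * Matrix.of (Y' u) := by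
    filter_upwards [hKtW] with u hu
    simpa only [Equiv.apply_symm_apply] using hu
  -- non-degeneracy at `0`: the two FP operators and the nested-sliced composite system
  have hTW0' : (Matrix.of ((fun v => Matrix.of.symm (fromRows (τ₂ * Matrix.of (Q₁ v)) τ₁)) 0) * Matrix.of (W 0)).det ≠ 0 := by
    simp only [Equiv.apply_symm_apply, hQ₁₀, hW₀]; exact hTW0
  have hPW0' : (Matrix.of (P 0) * Matrix.of (W 0)).det ≠ 0 := by rw [hP₀, hW₀]; exact hPW0
  have h0 : (kkt (Matrix.of ((fun v => Matrix.of.symm (Matrix.of (H v) + (Matrix.of (Q₁ v))ᵀ * Matrix.of (G v) * Matrix.of (Q₁ v))) 0))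
      (fromRows (Matrix.of ((fun v => Matrix.of.symm (Matrix.of (Q₂ v) * Matrix.of (Q₁ v))) 0))
        (Matrix.of ((fun v => Matrix.of.symm (fromRows (τ₂ * Matrix.of (Q₁ v)) τ₁)) 0)))).det ≠ 0 := by
    simp only [Equiv.apply_symm_apply, hH₀, hQ₁₀, hQ₂₀, hG₀]
    rw [fromRows_assoc, det_kkt_reindex]
    exact det_kkt_compSliced_ne_zero H₀ Q₁₀ Q₂₀ G₀ τ₁ τ₂ hS h1 h2
  -- §2: exchange the one-shot slice `P` for the nested comb slice, Faddeev–Popov second variations displayed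
  have hSX := secondVar_kkt_slice_change h𝔎 h𝔎₁ h𝔔 h𝔔₁ h𝔗 h𝔗₁ hP hPd hW hWd hKW' hKtW' hQW' hTW0' hPW0' h0
  simp only [Equiv.apply_symm_apply, hH₀, hH₁₀, hQ₁₀, hQ₁₁, hQ₂₀, hQ₂₁, hG₀, hG₁, hP₀, hP₁, hW₀, hW₁₀] at hSX
  -- regroup the rows and apply the nested step law with the corner killed, at the jets at `0`
  rw [hSX, secondVar_kkt_fromRows_assoc,
    secondVar_nestedStepLaw_corner H₀ H₁₀ H₂ Q₁₀ Q₁₁ Q₁dd Q₂₀ Q₂₁ Q₂dd G₀ G₁ Gdd τ₁ τ₂ hΓ hI hL hS hB h1 h2]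

end LawDefect

end Summit.QuantumFields.BalabanUV.Beta.FP.SliceExchangeDefect

end
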